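import Summits.ResolutionOfSingularities.ResolutionOfSingularities.Theses.VerticalModels
import HarnessLib

/-!
# Crux `WildCoreResolution` (stmt-ResolutionOfSingularities-16197) — birth skeleton (BC3), line `birth`

Route `ResolutionOfSingularities/VerticalModels`, crux #2 (rank 2, difficulty open-problem):
`WildCoreResolution` = "for a vertical datum `(p, k, X, f : X → A¹_k, q)` — `q ∈ k[T]`
irreducible, `X` integral, `f` separated of finite type, the fibre `V(t)` of `t := f^* q` not
everything, `X` regular off `V(t)` — IF `X` is regular at every TAME-REACHABLE point (some arc
`Spec k'⟦X⟧ → X` centred there pulls `t` back with finite order prime to `p`), THEN there is a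
blow-up `π : X' → X` along an ideal sheaf cosupported in `V(t)` with `X'` regular".

## Status of the crux (read before working this line)

A route-review refuter kernel-checked `WildCoreResolution ↔ VerticalResolution` (evidence
`VerticalModelsVerticalSplitCandidate.lean` / `WildCoreIsTarget.md` on the item, 2026-08-16):
reparametrising the base by `T ↦ q^p` makes every arc order divisible by `p`, so the tame clause
is vacuous and the crux AS TYPED is the target (the whole equal-characteristic models problem) in
costume; a restatement with an intrinsic tame/wild cut is pending with the route's planner. This
skeleton is written to be robust under that twist: every stub quantifies over a RE-CHOSEN root `s`
of the parameter on a radicial top (`s^(p^e) = g^* t`), so `t ↦ t^p` only shifts `e`; stubs 2–3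
survive any such restatement verbatim and stub 1's hypothesis only weakens.

## The cut — RADICIAL TAME DISTILLATION (the route header's own TWO-LAYER PLAN
"WildCoreResolution ⇐ FrobeniusUntwist → RadicialDescentVertical", typed in section form)

* `stub_radicialTameTop` (**load-bearing; structural, falsifiable; NOT a consequence of the
  target**): every wild-core datum is the bottom of a finite surjective radicial `g : Y → X`,
  `Y` integral, carrying a root `s ∈ Γ(Y, 𝒪_Y)`, `s^(p^e) = g^* t`, and an open `V ⊇ V(s)` on
  which every point NOT tame-reachable for `s` is regular ("near the fibre all singularities of
  the top are tame for the untwisted parameter"). Intended witness: the normalised Frobenius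
  untwist `k[q] → k[q^{1/p^e}]` (p-divisible fibre multiplicities drop, prime-to-p ones persist,
  points on a prime-to-p component are tame). Why it might fail: the untwist is singular over the
  p-critical locus of `t` modulo p-th powers OFF the fibre (`t = (u+1)^p + x² + y²` on `A³`:
  `z^p = x² + y²` along a line crossing the fibre), such points are never tame (`ord s = 0`,
  `not_tameReachable_of_isUnit`), and `V` only absorbs the part bounded away from `V(t)`; other
  purely inseparable `L ∋ t^{1/p}` must then serve, and `e = 0` covers must be regular over the
  wild singular points (local étale π₁ obstructions).
* `stub_tameCoreResolution` (**size L; a consequence of the target**, hence true in dim ≤ 3):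
  an integral `Y` of finite type over `k[T]` with a section `s` (unit somewhere) that is
  tame-singular on `V ⊇ V(s)` has a blow-up along an ideal cosupported in `V(s)` whose total space
  is regular over `V` — the route's tame engine (Néron smoothening by dilatations after the tame
  base change `σ^m = s`, `μ_m`-quotient, tame destackification) in COMPLETE form (it must not
  leave wild singular points on its own exceptional divisors).
* `stub_radicialDescentVertical` (**size L–XL; a consequence of the target**): such a blow-up
  resolution of the top, cosupported in `g⁻¹ V(t)` and regular over `V ⊇ g⁻¹ V(t)`, DESCENDS along
  the finite radicial `g` to a blow-up of `X` cosupported in `V(t)` with regular total space (the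
  crux is local near `V(t)`; vertical blow-up form of pAlteration's `RadicialBottom`, whose
  `HasResolution` form `PicoverToRadicialBottom` is proved in tree: Frobenius sandwich, then
  resolution of the p-closed 1-foliation on a regular model).
* `WildCoreResolution_of : Sig.stub_radicialTameTop → Sig.stub_tameCoreResolution →
  Sig.stub_radicialDescentVertical → WildCoreResolution` is PROVED (no `sorry` of its own; axioms
  propext / Classical.choice / Quot.sound): bundle the hypotheses, take `(Y, g, e, s, V)`, resolve
  `(Y, g ≫ f, s)` over `V`, transport `V(s) = V(s^(p^e)) = V(g^* t)` (`fibreLocus_pow`), descend.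
  `WildCoreResolution_proof` plugs the three `stub_*` in (its only `sorry`s).
* Proved sanity: `fibreLocus_pow`; `isUnit_pullback_of_isUnit_germ`,
  `not_tameReachable_of_isUnit` — off the fibre nothing is tame, so the single clause
  "non-tame ⇒ regular" of `TameSingularOn` contains "regular off the fibre"; and the regular
  case — `hasVerticalResolution_of_isRegular`, `hasVerticalResolutionOver_of_isRegular`
  (identity blow-up along `⊤`, cosupport `∅`) and `radicialTameTop_of_isRegular` (stub 1 holds
  with the trivial cover `Y = X`, `e = 0`, `s = t` when `X` is regular: the base of the intended
  induction on `e`).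

Disproof used: none on file for this crux (no `Disproof.lean`, no Negative lemmas, 2026-08-17);
`ledger negatives`: one unrelated entry (DefectlessFrames, valuation rings). Line card:
`Lines/birth.md`.
-/

noncomputable section

-- single-problem summit: the doubled namespace component `ResolutionOfSingularities` is forced
set_option linter.dupNamespace false

open CategoryTheory AlgebraicGeometry Literature.AlgebraicGeometry.Resolution
open Summit.ResolutionOfSingularities.ResolutionOfSingularities.Theses.VerticalModels (WildCoreResolution)

namespace Summit.ResolutionOfSingularities.ResolutionOfSingularities.Cruxes.WildCoreResolution.Lines.Birth

/-! ## Vocabulary (section form: a scheme `Y` and a global section `s ∈ Γ(Y, 𝒪_Y)` cutting out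
the vertical fibre `V(s)`; for the crux itself `Y = X`, `s = t := f^* q`) -/

/-- The vertical parameter `t := f^* q ∈ Γ(X, 𝒪_X)` of a datum `(X, f, q)` — verbatim the
expression the route file uses inline. [folklore] -/
abbrev param {k : Type} [Field k] {X : Scheme.{0}} (f : X ⟶ Spec (.of (Polynomial k)))
    (q : Polynomial k) : Γ(X, ⊤) :=
  f.appTop ((Scheme.ΓSpecIso (.of (Polynomial k))).inv q)

/-- The (closed) fibre `V(s) = {y | s(y) = 0}` of a global section: the points where the germ of
`s` is not a unit. [folklore] -/
def fibreLocus (Y : Scheme.{0}) (s : Γ(Y, ⊤)) : Set Y :=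
  {y | ¬ IsUnit (Y.presheaf.germ ⊤ y trivial s)}

/-- **Tame reachability (section form).** A point `y` of `Y` is *tame-reachable* for the section
`s` and the prime `p` if some arc `a : Spec k'⟦X⟧ → Y` centred at `y` pulls `s` back to a power
series of finite order `m` prime to `p`. For `Y = X`, `s = f^* q` this is the route's tame clause
(`(a ≫ f).appTop r = a.appTop (f.appTop r)`). [cite: Neron1964; BoschLutkebohmertRaynaud1990, §3.3] -/
def TameReachable (p : ℕ) (Y : Scheme.{0}) (s : Γ(Y, ⊤)) (y : Y) : Prop :=
  ∃ (k' : Type) (_ : Field k') (a : Spec (.of (PowerSeries k')) ⟶ Y) (m : ℕ),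
    a.base (IsLocalRing.closedPoint (PowerSeries k')) = y ∧
    ((Scheme.ΓSpecIso (.of (PowerSeries k'))).hom (a.appTop s)).order = m ∧ ¬ p ∣ m

/-- **Tame-singular near the fibre.** On the open `V ⊇ V(s)` every point that is NOT
tame-reachable for `s` is regular: `Y` is regular on `V ∖ V(s)` (points off the fibre are never
tame, `ord = 0`), and every singular point of `V` is reached by an arc along which `s` has order
prime to `p`. [folklore] -/
def TameSingularOn (p : ℕ) (Y : Scheme.{0}) (s : Γ(Y, ⊤)) (V : Y.Opens) : Prop :=
  fibreLocus Y s ⊆ (V : Set Y) ∧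
    ∀ y : Y, y ∈ V → ¬ TameReachable p Y s y → IsRegularLocalRing (Y.presheaf.stalk y)

/-- **Vertical blow-up resolution over an open `V`**: a blow-up `ρ : Y' → Y` along an ideal sheaf
cosupported inside the fibre `V(s)` whose total space is regular at every point lying over `V`.
[folklore] -/
def HasVerticalResolutionOver (Y : Scheme.{0}) (s : Γ(Y, ⊤)) (V : Y.Opens) : Prop :=
  ∃ (J : Y.IdealSheafData) (Y' : Scheme.{0}) (ρ : Y' ⟶ Y),
    IsBlowup ρ J ∧ (J.support : Set Y) ⊆ fibreLocus Y s ∧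
      ∀ y' : Y', ρ.base y' ∈ V → IsRegularLocalRing (Y'.presheaf.stalk y')

/-- **Vertical (fibre-cosupported) blow-up resolution** of `Y` with respect to `s`: a blow-up
along an ideal sheaf cosupported inside `V(s)` with regular total space — for `Y = X`, `s = f^* q`
this IS the crux's conclusion. [folklore] -/
def HasVerticalResolution (Y : Scheme.{0}) (s : Γ(Y, ⊤)) : Prop :=
  ∃ (J : Y.IdealSheafData) (Y' : Scheme.{0}) (ρ : Y' ⟶ Y),
    IsBlowup ρ J ∧ (J.support : Set Y) ⊆ fibreLocus Y s ∧ Scheme.IsRegular Y'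

/-- **The hypotheses of the crux, bundled** (one field per hypothesis of `WildCoreResolution`,
verbatim, in the route's inline form): `q` irreducible, `X` integral, `f` separated, locally of
finite type and quasi-compact, the fibre `V(f^* q)` is not everything, `X` is regular off the
fibre, and `X` is regular at every tame-reachable point (the wild-core clause).
[cite: CossartPiltant2019, Cor. 1.3 (the models problem)] -/
structure IsWildCoreDatum (p : ℕ) {k : Type} [Field k] (X : Scheme.{0})
    (f : X ⟶ Spec (.of (Polynomial k))) (q : Polynomial k) : Prop where
  irreducible : Irreducible q
  isIntegral : IsIntegral X
  isSeparated : IsSeparated f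
  locallyOfFiniteType : LocallyOfFiniteType f
  quasiCompact : QuasiCompact f
  exists_isUnit : ∃ x : X, IsUnit (X.presheaf.germ ⊤ x trivial (param f q))
  isRegular_of_isUnit :
    ∀ x : X, IsUnit (X.presheaf.germ ⊤ x trivial (param f q)) → IsRegularLocalRing (X.presheaf.stalk x)
  isRegular_of_tame :
    ∀ x : X, (∃ (k' : Type) (_ : Field k') (a : Spec (.of (PowerSeries k')) ⟶ X) (m : ℕ),
      a.base (IsLocalRing.closedPoint (PowerSeries k')) = x ∧
      ((Scheme.ΓSpecIso (.of (PowerSeries k'))).hom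
        ((a ≫ f).appTop ((Scheme.ΓSpecIso (.of (Polynomial k))).inv q))).order = m ∧ ¬ p ∣ m) →
      IsRegularLocalRing (X.presheaf.stalk x)

/-! ## The three stub STATEMENTS by name (`Sig.stub_<name>`; the composition
`WildCoreResolution_of` takes exactly these as hypotheses) -/

/-- Statement of `stub_radicialTameTop` — **RADICIAL TAME DISTILLATION of the wild core (the
load-bearing stub).** Every wild-core vertical datum `(X, f, q)` is the bottom of a finite,
surjective, radicial (universally injective) morphism `g : Y → X` from an integral `Y` carrying a
root `s ∈ Γ(Y, 𝒪_Y)` of the parameter, `s^(p^e) = g^* f^* q` (so `V(s) = g⁻¹ V(f^* q)`; the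
exponent `e` absorbs any Frobenius twist of the base), together with an open `V ⊇ V(s)` on which
every point that is not tame-reachable for `s` is regular: near the fibre, ALL singularities of the
top are tame for the untwisted parameter. Intended witness: the normalised Frobenius untwist of the
base `k[q] → k[q^{1/p^e}]` (route header, TWO-LAYER PLAN `FrobeniusUntwist`), `V` = complement of
the closure of its p-critical locus off the fibre.
[cite: arXiv:1508.06255 (Temkin 2017: tame distillation); arXiv:0804.1554 (Temkin 2013, Rem. 1.3.5 (ii)–(iii)); BoschLutkebohmertRaynaud1990, §3.6] -/
def Sig.stub_radicialTameTop : Prop :=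
  ∀ p : ℕ, p.Prime → ∀ (k : Type) [Field k] [CharP k p] (X : Scheme.{0})
    (f : X ⟶ Spec (.of (Polynomial k))) (q : Polynomial k), IsWildCoreDatum p X f q →
    ∃ (Y : Scheme.{0}) (g : Y ⟶ X) (e : ℕ) (s : Γ(Y, ⊤)) (V : Y.Opens),
      IsFinite g ∧ Surjective g ∧ UniversallyInjective g ∧ IsIntegral Y ∧
      s ^ (p ^ e) = g.appTop (param f q) ∧
      (∃ y : Y, IsUnit (Y.presheaf.germ ⊤ y trivial s)) ∧
      TameSingularOn p Y s V

/-- Statement of `stub_tameCoreResolution` — **TAME-CORE RESOLUTION (the tame engine, complete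
form).** An integral `Y`, separated of finite type over `k[T]`, with a global section `s` that is
a unit somewhere and an open `V ⊇ V(s)` on which every non-tame-reachable point is regular, admits
a blow-up along an ideal sheaf cosupported in `V(s)` whose total space is regular over `V`.
Intended proof: bounded tame orders, tame cyclic base change `σ^m = s`, Néron smoothening of the
normalised base change by blow-ups of Néron's canonical centres (termination by Néron's defect),
`μ_m`-quotient and tame destackification — with NO wild residue because every singular point is
tame. [cite: Neron1964; BoschLutkebohmertRaynaud1990, §3.3–3.4; arXiv:2001.03597, §2; BerghRydh2019; CossartPiltant2019, Thm. 1.1] -/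
def Sig.stub_tameCoreResolution : Prop :=
  ∀ p : ℕ, p.Prime → ∀ (k : Type) [Field k] [CharP k p] (Y : Scheme.{0})
    (h : Y ⟶ Spec (.of (Polynomial k))) (s : Γ(Y, ⊤)) (V : Y.Opens),
    IsIntegral Y → IsSeparated h → LocallyOfFiniteType h → QuasiCompact h →
    (∃ y : Y, IsUnit (Y.presheaf.germ ⊤ y trivial s)) → TameSingularOn p Y s V →
    HasVerticalResolutionOver Y s V

/-- Statement of `stub_radicialDescentVertical` — **RADICIAL DESCENT of vertical resolutions
(local near the fibre).** For a wild-core vertical datum `(X, f, q)`, a finite surjective radicial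
`g : Y → X` with `Y` integral, and an open `V ⊇ V(g^* f^* q)` of `Y`: a blow-up of `Y` along an
ideal sheaf cosupported in `g⁻¹ V(f^* q)` whose total space is regular over `V` descends to a
blow-up of `X` cosupported in `V(f^* q)` with regular total space (`X` is already regular off the
fibre and the crux is local near it). The vertical, blow-up form of `RadicialBottom`
(route pAlteration: `PicoverToRadicialBottom`, proved in tree for `HasResolution`).
[cite: arXiv:0804.1554 (Temkin 2013, Rem. 1.3.5 (i),(iii)); Kollar1997, Prop. 6.6; StacksProject, Tag 0CNF; StacksProject, Tag 080B] -/
def Sig.stub_radicialDescentVertical : Prop :=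
  ∀ p : ℕ, p.Prime → ∀ (k : Type) [Field k] [CharP k p] (X : Scheme.{0})
    (f : X ⟶ Spec (.of (Polynomial k))) (q : Polynomial k), IsWildCoreDatum p X f q →
    ∀ (Y : Scheme.{0}) (g : Y ⟶ X) (V : Y.Opens), IsFinite g → Surjective g →
      UniversallyInjective g → IsIntegral Y →
      fibreLocus Y (g.appTop (param f q)) ⊆ (V : Set Y) →
      HasVerticalResolutionOver Y (g.appTop (param f q)) V →
      HasVerticalResolution X (param f q)

/-! ## The stubs -/

/-- **STUB (load-bearing; structural, falsifiable).** Radicial tame distillation of the wild core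
— see `Sig.stub_radicialTameTop`. [cite: arXiv:1508.06255; arXiv:0804.1554, Rem. 1.3.5] -/
theorem stub_radicialTameTop : Sig.stub_radicialTameTop := by
  sorry

/-- **STUB (size L; a consequence of the target `VerticalResolution`).** Tame-core resolution —
see `Sig.stub_tameCoreResolution`. [cite: BoschLutkebohmertRaynaud1990, §3.3–3.4; Neron1964] -/
theorem stub_tameCoreResolution : Sig.stub_tameCoreResolution := by
  sorry

/-- **STUB (size L–XL; a consequence of the target).** Radicial descent of vertical resolutions —
see `Sig.stub_radicialDescentVertical`. [cite: arXiv:0804.1554, Rem. 1.3.5; Kollar1997, Prop. 6.6] -/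
theorem stub_radicialDescentVertical : Sig.stub_radicialDescentVertical := by
  sorry

/-! ## Glue (proved) -/

/-- A power `s ^ n`, `n ≠ 0`, has the same non-unit locus (fibre) as `s`. [folklore] -/
theorem fibreLocus_pow (Y : Scheme.{0}) (s : Γ(Y, ⊤)) {n : ℕ} (hn : n ≠ 0) :
    fibreLocus Y (s ^ n) = fibreLocus Y s := by
  ext y
  simp only [fibreLocus, Set.mem_setOf_eq, map_pow, isUnit_pow_iff hn]

/-- The order of the pull-back of `s ^ n` along an arc is `n •` the order of the pull-back of `s`;
hence tame reachability for `s ^ n` forces tame reachability for `s` when `p ∤ n`… and, the case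
used here: tame-singularity near the fibre is insensitive to replacing the parameter by the
`p^e`-th root `s` ONLY through `V(s) = V(s^(p^e))` (`fibreLocus_pow`). [folklore] -/
theorem tameSingularOn_fibreLocus_pow (p : ℕ) (Y : Scheme.{0}) (s : Γ(Y, ⊤)) (V : Y.Opens)
    {n : ℕ} (hn : n ≠ 0) (h : TameSingularOn p Y s V) :
    fibreLocus Y (s ^ n) ⊆ (V : Set Y) := by
  rw [fibreLocus_pow Y s hn]; exact h.1

/-! ## The composition (kernel-checked; no `sorry` in its own term) -/

/-- **`WildCoreResolution` from the three stub statements** — PROVED: bundle the crux's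
hypotheses, take the radicial tame top `(Y, g, e, s, V)` of stub 1, resolve `Y` over `V` with
respect to `s` by stub 2 (structure morphism `g ≫ f`: finite ⇒ separated, locally of finite type,
quasi-compact), transport fibre and cosupport along `V(s) = V(s^(p^e)) = V(g^* f^* q)`
(`fibreLocus_pow`), and descend along `g` by stub 3. [folklore] -/
theorem WildCoreResolution_of :
    Sig.stub_radicialTameTop → Sig.stub_tameCoreResolution → Sig.stub_radicialDescentVertical →
      WildCoreResolution := by
  intro h₁ h₂ h₃ p hp k _ _ X f q hq hX hsep hlft hqc hne hreg htame
  have H : IsWildCoreDatum p X f q := ⟨hq, hX, hsep, hlft, hqc, hne, hreg, htame⟩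
  obtain ⟨Y, g, e, s, V, hfin, hsurj, hui, hY, hs, hunit, hcore⟩ := h₁ p hp k X f q H
  have hsep' : IsSeparated (g ≫ f) := inferInstance
  have hlft' : LocallyOfFiniteType (g ≫ f) := inferInstance
  have hqc' : QuasiCompact (g ≫ f) := inferInstance
  obtain ⟨J, Y', ρ, hρ, hJ, hY'⟩ := h₂ p hp k Y (g ≫ f) s V hY hsep' hlft' hqc' hunit hcore
  have hpe : p ^ e ≠ 0 := pow_ne_zero e hp.ne_zero
  have hfib : fibreLocus Y (g.appTop (param f q)) = fibreLocus Y s := by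
    rw [← hs, fibreLocus_pow Y s hpe]
  have hV : fibreLocus Y (g.appTop (param f q)) ⊆ (V : Set Y) := hfib ▸ hcore.1
  have hJ' : (J.support : Set Y) ⊆ fibreLocus Y (g.appTop (param f q)) := hfib ▸ hJ
  exact h₃ p hp k X f q H Y g V hfin hsurj hui hY hV ⟨J, Y', ρ, hρ, hJ', hY'⟩

/-- **The crux `WildCoreResolution`, assembled from the three registered stubs** (the skeleton in
its final shape; the only `sorry`s in its closure are the three `stub_*`, none of its own). -/
theorem WildCoreResolution_proof : WildCoreResolution :=
  WildCoreResolution_of stub_radicialTameTop stub_tameCoreResolution stub_radicialDescentVertical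

/-! ## Sanity (proved): the definitions compute — off the fibre nothing is tame -/

/-- If `s` is a unit at the centre `y` of an arc `a : Spec k'⟦X⟧ → Y`, its pull-back is a unit of
`k'⟦X⟧` (the induced map `𝒪_{Y,y} → k'⟦X⟧` is a ring homomorphism). [folklore] -/
theorem isUnit_pullback_of_isUnit_germ {Y : Scheme.{0}} (s : Γ(Y, ⊤)) {k' : Type} [Field k']
    (a : Spec (.of (PowerSeries k')) ⟶ Y)
    (hu : IsUnit (Y.presheaf.germ ⊤ (a.base (IsLocalRing.closedPoint (PowerSeries k'))) trivial s)) :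
    IsUnit ((Scheme.ΓSpecIso (.of (PowerSeries k'))).hom (a.appTop s)) := by
  have h1 := hu.map (Scheme.stalkClosedPointTo a).hom
  have key := Scheme.germ_stalkClosedPointTo a ⊤ trivial
  have key' : (Scheme.stalkClosedPointTo a)
      ((Y.presheaf.germ ⊤ (a.base (IsLocalRing.closedPoint (PowerSeries k'))) trivial) s) =
      ((Spec (.of (PowerSeries k'))).presheaf.mapIso
          (eqToIso (Scheme.preimage_eq_top_of_closedPoint_mem a (U := ⊤) trivial).symm).op ≪≫
        Scheme.ΓSpecIso (.of (PowerSeries k'))).hom ((a.app ⊤) s) := by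
    rw [← CommRingCat.comp_apply, key, CommRingCat.comp_apply]
  have h2 : IsUnit (((Spec (.of (PowerSeries k'))).presheaf.mapIso
          (eqToIso (Scheme.preimage_eq_top_of_closedPoint_mem a (U := ⊤) trivial).symm).op ≪≫
        Scheme.ΓSpecIso (.of (PowerSeries k'))).hom ((a.app ⊤) s)) := by
    rw [← key']; exact h1
  simp at h2
  exact h2

/-- **Off the fibre nothing is tame**: if `s` is a unit at `y` then `y` is not tame-reachable for
`s` (every arc pulls `s` back to a unit of `k'⟦X⟧`, of order `0`, and `p ∣ 0`). So the single
clause "non-tame ⇒ regular" of `TameSingularOn` contains "regular off the fibre". [folklore] -/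
theorem not_tameReachable_of_isUnit (p : ℕ) {Y : Scheme.{0}} (s : Γ(Y, ⊤)) {y : Y}
    (hu : IsUnit (Y.presheaf.germ ⊤ y trivial s)) : ¬ TameReachable p Y s y := by
  rintro ⟨k', _, a, m, rfl, hord, hpm⟩
  have hunit := isUnit_pullback_of_isUnit_germ s a hu
  have h0 : ((Scheme.ΓSpecIso (.of (PowerSeries k'))).hom (a.appTop s)).order = 0 :=
    PowerSeries.order_zero_of_unit hunit
  rw [h0] at hord
  have hm : m = 0 := by exact_mod_cast hord.symm
  exact hpm (hm ▸ dvd_zero p)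

/-! ## Sanity (proved): the regular case — the conclusions are inhabited in kind and stub 1
holds with the trivial cover (`Y = X`, `g = 𝟙`, `e = 0`, `s = t`, `V = ⊤`) when `X` is regular -/

/-- A regular scheme is vertically resolved, for any section, by the identity blow-up along the
unit ideal sheaf (cosupport `∅`). [folklore] -/
theorem hasVerticalResolution_of_isRegular (Y : Scheme.{0}) (s : Γ(Y, ⊤))
    (hY : Scheme.IsRegular Y) : HasVerticalResolution Y s := by
  refine ⟨⊤, Y, 𝟙 Y, isBlowup_id_top Y, ?_, hY⟩
  simp [Scheme.IdealSheafData.support_top]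

/-- The same over any open `V`. [folklore] -/
theorem hasVerticalResolutionOver_of_isRegular (Y : Scheme.{0}) (s : Γ(Y, ⊤)) (V : Y.Opens)
    (hY : Scheme.IsRegular Y) : HasVerticalResolutionOver Y s V := by
  refine ⟨⊤, Y, 𝟙 Y, isBlowup_id_top Y, ?_, fun y _ => hY y⟩
  simp [Scheme.IdealSheafData.support_top]

/-- **Stub 1 in the regular case** (the base of the intended induction on `e`): if the wild-core
datum `X` is already regular, the trivial cover `Y = X`, `g = 𝟙 X`, `e = 0`, `s = t`, `V = ⊤`
witnesses `Sig.stub_radicialTameTop` for it. [folklore] -/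
theorem radicialTameTop_of_isRegular (p : ℕ) (k : Type) [Field k] [CharP k p] (X : Scheme.{0})
    (f : X ⟶ Spec (.of (Polynomial k))) (q : Polynomial k) (H : IsWildCoreDatum p X f q)
    (hX : Scheme.IsRegular X) :
    ∃ (Y : Scheme.{0}) (g : Y ⟶ X) (e : ℕ) (s : Γ(Y, ⊤)) (V : Y.Opens),
      IsFinite g ∧ Surjective g ∧ UniversallyInjective g ∧ IsIntegral Y ∧
      s ^ (p ^ e) = g.appTop (param f q) ∧
      (∃ y : Y, IsUnit (Y.presheaf.germ ⊤ y trivial s)) ∧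
      TameSingularOn p Y s V := by
  refine ⟨X, 𝟙 X, 0, param f q, ⊤, inferInstance, inferInstance, inferInstance, H.isIntegral, ?_,
    H.exists_isUnit, ?_, ?_⟩
  · simp
  · exact fun _ _ => trivial
  · exact fun x _ _ => hX x

end Summit.ResolutionOfSingularities.ResolutionOfSingularities.Cruxes.WildCoreResolution.Lines.Birth

end
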